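import Literature.Computability.AlgebraicComplexity.BorderRankMatMulThreeHalves
import Literature.Computability.AlgebraicComplexity.AsymptoticSpectrum
import Literature.Computability.AlgebraicComplexity.QuantumFunctionalsUpper
import HarnessLib

/-!
# `G_s`-obstructions give only trivial border-rank bounds; a first `G`-obstruction for `⟨n,n,n⟩` (Bürgisser–Ikenmeyer, STOC 2011)

Topic `Literature/Computability/AlgebraicComplexity` (geometric complexity theory, tensor setting).
Typed-chain item of the cell `pub-gct-max` (track T, seat lit-2): statements of P. Bürgisser,
C. Ikenmeyer, *Geometric complexity theory and tensor rank*, STOC 2011, pp. 509–518 =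
arXiv:1011.1350 [BurgisserIkenmeyer2011], AS PRINTED (numbering of the arXiv version, which the
tree's other files cite: Def. 3.1, Prop. 3.6, Thm. 4.6, Lemma 6.1, …), in the tree's vocabulary.
Honest framing of the cell: multiplicity data and certified rank bounds at small parameters;
nothing here is a claim on VP vs VNP or P vs NP.

## What is printed (arXiv version)

* §2.2: `G := GL(W₁) × GL(W₂) × GL(W₃)`; "`R̲(w) ≤ m` iff `w ⊴ ⟨m⟩`" (`⟨m⟩ = ∑ⱼ e¹ⱼ ⊗ e²ⱼ ⊗ e³ⱼ`
  the unit tensor, `w ⊴ v` iff `\overline{Gw} ⊆ \overline{Gv}`).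
* Def. 3.1: "The *semigroup of representations* `S(w)` of a tensor `w ∈ W` is defined as
  `S(w) := {λ | V_λ(G)^* occurs in 𝒪(\overline{Gw})}`." with `λ = (λ₁, λ₂, λ₃)`,
  `λᵢ ⊢_{mᵢ} d` when it occurs in degree `d`; (3.1): "`\overline{Gw} ⊆ \overline{Gv} ⟹ S(w) ⊆ S(v)`.
  In particular, exhibiting some `λ ∈ S(w) ∖ S(v)` proves that `\overline{Gw}` is not contained in
  `\overline{Gv}`. If `v = ⟨m⟩`, this establishes the lower bound `R̲(w) > m`."
  Prop. 3.3 (inheritance): `S(w) = S(w′)` for `w′` the image of `w` in a larger format.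
* §3.4: `S°(w) := {λ | V_λ(G)^* occurs in 𝒪(Gw)}` "clearly contains `S(w)`"; Prop. 3.4:
  `S°(w) = {λ | V_λ(G)^H ≠ 0}`, `H = stab(w)`.
* §3.5: `G_s := SL(W₁) × SL(W₂) × SL(W₃)`; Def. 3.5: "`w` is called *stable*, iff `G_s w` is
  closed"; `π : Λ⁺_G → Λ⁺_{G_s}` the residue map modulo `ℤε_{mᵢ}`, `ε_{mᵢ} = (1,…,1)`;
  `S_s(w) := π(S(w))`, `S°_s(w) := π(S°(w))` "describe the irreducible `G_s`-modules occurring in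
  `𝒪(\overline{Gw})` and `𝒪(Gw)`". **Prop. 3.6**: "If `w` is stable, then `S_s(w) = S°_s(w)`."
  with proof via (3.2): "`∀ λ ∈ S°(w) ∃ k ∈ ℤ  λ + kε_m ∈ S(w)`".
* Prop. 4.1 (stabiliser of `⟨m⟩`), **Prop. 4.2**: "The unit tensor `⟨m⟩` is stable."
  Thm. 4.4 (`dim (V_λ)^{H_m}` as a sum over `α ⪯ λ₁ ⋏ λ₂ ⋏ λ₃`), Cor. 4.5.
* **Thm. 4.6**: "For any `λ ∈ Λ⁺_d(m,m,m)` there exists `k ∈ ℕ` such that `λ′ ∈ S°(⟨m+1⟩)`,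
  where `λᵢ = (λᵢ¹, …, λᵢᵐ)` and `λ′ᵢ = (λᵢ¹ + k, …, λᵢᵐ + k, 0)`." followed by: "Theorem 4.6 has
  severe consequences. It tells us that for any tensor `w` of format `(m,m,m)`, the trivial lower
  bound `R̲(w) > m` is the best that can be shown using `G_s`-obstructions!" and (§1) "It does not
  kill the overall program, but implies, unlike proposed in [28, 29], that the finer
  `G`-representations have to be considered instead."
* **Lemma 6.1** (frequency notation `k₁^{e₁} k₂^{e₂} ⋯`): "We have
  `λₙ := (2^{n²} 0, 2^{n²} 0, (2n²−3) 1 1 1 0^{n²−3}) ∈ S(⟨n,n,n⟩) ∖ S°(⟨n²+1⟩)` for `n ≥ 2`.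
  This implies `R̲(⟨n,n,n⟩) > n² + 1`." Rem. 6.2(2): "Lemma 6.1 yields `R̲(⟨2,2,2⟩) > 5`. It is
  known [23] that `R̲(⟨2,2,2⟩) = 7`. So far we have been unable to reach the optimal lower bound by
  an obstruction." §6.2 (Strassen's invariant): the weight `λ′₄` of Strassen's degree-12 invariant
  for format `(4,4,3)` DOES occur in `S(⟨5⟩)` ("the conjecture is already false for `m = 4`!").
* Thm. 7.1 / Cor. 7.2 (extension problem; `\overline{G⟨n,n,n⟩}` not normal for `n > 1`,
  `\overline{G⟨m⟩}` not normal for `m ≥ 5`), §8 (moment polytopes: Def. 8.1, Problem 8.3,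
  Thm. 8.4 `P°(⟨m⟩) = Δ(m,m,m)`, `P°(⟨n,n,n⟩) = Δ(n²,n²,n²)`, Cor. 8.6).

## What is here (occurrence written as in `UnitTensorMomentPolytope.lean` / `IsotypicPressure.lean`:
## type `λ = (λ⁰,λ¹,λ²) ⊢ d` occurs in `𝒪(\overline{GL³·t})_d`, i.e. `λ ∈ S(t)` in degree `d`, iff the
## triple isotypic character sum `isotypicSum₁ λ⁰ (isotypicSum₂ λ¹ (isotypicSum₃ λ² t^{⊗d}))` of
## `QuantumFunctionalsUpper.lean` is non-zero — the standing Schur–Weyl identification of those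
## files, not re-proved here)

* `burgisserIkenmeyer2011_thm_4_6` — NAMED FACT (not discharged): the CLOSURE-SEMIGROUP FORM of
  Thm. 4.6. The printed theorem is about the orbit semigroup `S°(⟨m+1⟩)`, for which the tree has
  no vocabulary; since `⟨m+1⟩` is stable (Prop. 4.2), Prop. 3.6 in its proof form (3.2) turns
  `λ′ ∈ S°(⟨m+1⟩)` into `λ′ + c·ε ∈ S(⟨m+1⟩)` for some `c ∈ ℤ`, necessarily `c ≥ 0` (the last
  entry of `λ′ᵢ` is `0` and members of `S` are triples of partitions). Hence, AS A CONSEQUENCE OF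
  THE PRINTED Thm. 4.6 + Prop. 4.2 + Prop. 3.6: for every `λ ∈ Λ⁺_d(m,m,m)` there are `s ≥ c ≥ 0`
  (`s = k + c`) such that `((λᵢ¹+s, …, λᵢᵐ+s, c))_{i=1,2,3} ∈ S(⟨m+1⟩)` (degree `d + ms + c`).
  This is exactly why `G_s`-obstructions — highest weights read modulo `(ℤε)³`, i.e. irreducible
  `SL³`-types — cannot separate any `w` of format `(m,m,m)` from `\overline{G⟨m+1⟩}`: every
  `G_s`-type of format `(m,m,m)` is the `G_s`-type of a member of `S(⟨m+1⟩)`.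
* `bi2011TwoRect n` (`2^{n²} ⊢ 2n²`), `bi2011Last n` (`(2n²−3, 1, 1, 1) ⊢ 2n²`, `n ≥ 2`) and
  `burgisserIkenmeyer2011_lemma_6_1` — NAMED FACT (not discharged): `λₙ ∈ S(⟨n,n,n⟩)` and
  `λₙ ∉ S(⟨n²+1⟩)` in degree `2n²`, for `n ≥ 2`. The printed non-occurrence is the STRONGER
  `λₙ ∉ S°(⟨n²+1⟩)` (orbit); we record its printed consequence for the closure
  (`S ⊆ S°`, §3.4), which is what (3.1) uses. Factor order: BI's `⟨n,n,n⟩ = M_U ∈ W₁₂ ⊗ W₂₃ ⊗ W₃₁`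
  has the OUTPUT space `W₃₁ ≅ Hom(U₃,U₁)` third, the tree's `matMulTensor K n n n` (Bläser's
  `⟨k,m,n⟩`, `MatrixMultiplicationExponent.lean`) has it FIRST; so BI's third component
  `(2n²−3,1,1,1)` sits on `isotypicSum₁`. (The `GL³`-orbit of `⟨n,n,n⟩` is invariant under
  permuting the three factors combined with transposition, so `S(⟨n,n,n⟩)` is symmetric anyway.)
* `burgisserIkenmeyer2011_lemma_6_1_bound` — the printed consequence "`R̲(⟨n,n,n⟩) > n² + 1`"
  (`n ≥ 2`) for the tree's `algBorderRank`; DISCHARGED (`…_holds`) from the tree's proved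
  Strassen–Lickteig bound `three_mul_sq_le_two_mul_algBorderRank_matMulTensor` (`3n² ≤ 2R̲`), as
  the numerical statement is far from new (Rem. 6.2(2)).

## Deliberately NOT here

`S°`, stabilisers and stability (Props. 3.4, 3.6, 4.1, 4.2, 5.1, 5.2 as separate statements),
Thm. 4.4 / Cor. 4.5 / Thm. 5.3 (invariant dimension formulas), §6.2, Thm. 7.1 / Cor. 7.2
(non-normality), §8 (moment polytopes; cf. `UnitTensorMomentPolytope.lean`, which records
Problem 8.3 and `Δ(⟨4⟩) = Kron₄₄₄`). The border rank is the tree's `algBorderRank` (algebraic,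
`SchoenhageTau.lean`), in which all printed border-rank bounds of the tree are stated; BI's `R̲` is
the topological border rank over `ℂ` (§2.1), the same number — a theorem-level remark, not used.
-/

noncomputable section

namespace Literature.Computability.AlgebraicComplexity

/-! ### Theorem 4.6 (closure-semigroup form): no `G_s`-obstructions beyond the trivial bound -/

/-- NAMED FACT (**Bürgisser–Ikenmeyer 2011, Thm. 4.6, in the closure-semigroup form obtained with
Prop. 4.2 and Prop. 3.6/(3.2)**; not discharged). Printed Thm. 4.6: "For any `λ ∈ Λ⁺_d(m,m,m)`
there exists `k ∈ ℕ` such that `λ′ ∈ S°(⟨m+1⟩)`, where `λᵢ = (λᵢ¹,…,λᵢᵐ)` and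
`λ′ᵢ = (λᵢ¹+k,…,λᵢᵐ+k,0)`"; Prop. 4.2: "The unit tensor `⟨m⟩` is stable"; (3.2) (= Prop. 3.6 for
stable `w`): "`∀ λ ∈ S°(w) ∃ k ∈ ℤ  λ + kε_m ∈ S(w)`". Consequence recorded here, for `m ≥ 1`,
every `d` and every triple `λ = (λ⁰,λ¹,λ²)` of partitions of `d` with at most `m` parts each: there
are natural numbers `c ≤ s` and the triple `λ′ = ((λʲ₁+s, …, λʲ_m+s, c))_{j}` of partitions of
`d + ms + c` (parts: the `m` zero-padded parts of `λʲ` shifted by `s`, and `c`; zeros dropped) such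
that `λ′` OCCURS in degree `d + ms + c` of `𝒪(\overline{GL³ · ⟨m+1⟩})` (`unitTensor ℂ (m+1)`;
occurrence = non-vanishing triple isotypic character sum, module docstring). Printed gloss: "for
any tensor `w` of format `(m,m,m)`, the trivial lower bound `R̲(w) > m` is the best that can be
shown using `G_s`-obstructions!" [cite: BurgisserIkenmeyer2011, Thm. 4.6 (with Prop. 4.2, Prop. 3.6)] -/
def burgisserIkenmeyer2011_thm_4_6 : Prop :=
  ∀ (m d : ℕ), 1 ≤ m → ∀ lam : Fin 3 → Nat.Partition d, (∀ j, (lam j).parts.card ≤ m) →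
    ∃ (s c : ℕ) (lam' : Fin 3 → Nat.Partition (d + m * s + c)), c ≤ s ∧
      (∀ j, (lam' j).parts =
        (((lam j).parts.map (· + s)) + Multiset.replicate (m - (lam j).parts.card) s + {c}).filter
          (· ≠ 0)) ∧
      isotypicSum₁ (lam' 0) (isotypicSum₂ (lam' 1) (isotypicSum₃ (lam' 2)
        (kroneckerPow (unitTensor ℂ (m + 1)) (d + m * s + c)))) ≠ 0

/-! ### Lemma 6.1: the obstruction `λₙ` -/

/-- The rectangular partition `2^{n²} = (2, …, 2) ⊢ 2n²` (`n²` parts) — the first two components of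
`λₙ` in Lemma 6.1. [cite: BurgisserIkenmeyer2011, Lemma 6.1] -/
def bi2011TwoRect (n : ℕ) : Nat.Partition (2 * n ^ 2) :=
  Nat.Partition.ofSums _ (Multiset.replicate (n ^ 2) 2) (by
    rw [Multiset.sum_replicate, smul_eq_mul]
    ring)

/-- The parts of `bi2011TwoRect n`. [cite: BurgisserIkenmeyer2011, Lemma 6.1] -/
theorem bi2011TwoRect_parts (n : ℕ) : (bi2011TwoRect n).parts = Multiset.replicate (n ^ 2) 2 := by
  rw [bi2011TwoRect, Nat.Partition.ofSums_parts, Multiset.filter_eq_self]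
  intro a ha
  rw [Multiset.mem_replicate] at ha
  omega

/-- The partition `(2n² − 3, 1, 1, 1) ⊢ 2n²` (frequency notation `(2n²−3) 1³ 0^{n²−3}`) — the third
component of `λₙ` in Lemma 6.1; needs `n ≥ 2` (then `2n² − 3 ≥ 5`, a genuine subtraction).
[cite: BurgisserIkenmeyer2011, Lemma 6.1] -/
def bi2011Last (n : ℕ) (hn : 2 ≤ n) : Nat.Partition (2 * n ^ 2) :=
  Nat.Partition.ofSums _ ({2 * n ^ 2 - 3} + Multiset.replicate 3 1) (by
    have h4 : 4 ≤ n ^ 2 := by nlinarith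
    rw [Multiset.sum_add, Multiset.sum_singleton, Multiset.sum_replicate, smul_eq_mul]
    omega)

/-- The parts of `bi2011Last n hn`. [cite: BurgisserIkenmeyer2011, Lemma 6.1] -/
theorem bi2011Last_parts (n : ℕ) (hn : 2 ≤ n) :
    (bi2011Last n hn).parts = {2 * n ^ 2 - 3} + Multiset.replicate 3 1 := by
  have h4 : 4 ≤ n ^ 2 := by nlinarith
  rw [bi2011Last, Nat.Partition.ofSums_parts, Multiset.filter_eq_self]
  intro a ha
  simp only [Multiset.mem_add, Multiset.mem_singleton, Multiset.mem_replicate] at ha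
  omega

/-- NAMED FACT (**Bürgisser–Ikenmeyer 2011, Lemma 6.1**; not discharged). Printed: "We have
`λₙ := (2^{n²} 0, 2^{n²} 0, (2n²−3) 1 1 1 0^{n²−3}) ∈ S(⟨n,n,n⟩) ∖ S°(⟨n²+1⟩)` for `n ≥ 2`."
Recorded: for `n ≥ 2`, in degree `2n²`, the type `λₙ` OCCURS in `𝒪(\overline{GL³ · ⟨n,n,n⟩})`
(`matMulTensor ℂ n n n`, BI's third = output component `(2n²−3,1,1,1)` on the tree's first =
output factor) and does NOT occur in `𝒪(\overline{GL³ · ⟨n²+1⟩})` (`unitTensor ℂ (n²+1)`) — the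
latter being the printed consequence `λₙ ∉ S(⟨n²+1⟩) ⊆ S°(⟨n²+1⟩)` (§3.4) of the printed orbit
statement; occurrence = non-vanishing triple isotypic character sum (module docstring). By (3.1)
this is a `G`-obstruction proving `R̲(⟨n,n,n⟩) > n² + 1` (`burgisserIkenmeyer2011_lemma_6_1_bound`).
Proof in print: Thm. 4.4 plus a tableau-straightening computation for the two relevant `α`, and
`g(λₙ) = 1` with an explicit highest weight vector evaluated at `⟨n,n,n⟩` ("guided by computer
calculations"). [cite: BurgisserIkenmeyer2011, Lemma 6.1] -/
def burgisserIkenmeyer2011_lemma_6_1 : Prop :=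
  ∀ (n : ℕ) (hn : 2 ≤ n),
    isotypicSum₁ (bi2011Last n hn) (isotypicSum₂ (bi2011TwoRect n) (isotypicSum₃ (bi2011TwoRect n)
        (kroneckerPow (matMulTensor ℂ n n n) (2 * n ^ 2)))) ≠ 0 ∧
      isotypicSum₁ (bi2011Last n hn) (isotypicSum₂ (bi2011TwoRect n)
          (isotypicSum₃ (bi2011TwoRect n) (kroneckerPow (unitTensor ℂ (n ^ 2 + 1)) (2 * n ^ 2)))) = 0

/-- **Bürgisser–Ikenmeyer 2011, Lemma 6.1 (printed consequence)**: "This implies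
`R̲(⟨n,n,n⟩) > n² + 1`" (`n ≥ 2`), for the tree's `algBorderRank` and `matMulTensor ℂ n n n`.
[cite: BurgisserIkenmeyer2011, Lemma 6.1] -/
def burgisserIkenmeyer2011_lemma_6_1_bound : Prop :=
  ∀ n : ℕ, 2 ≤ n → n ^ 2 + 1 < algBorderRank (matMulTensor ℂ n n n)

/-- Discharge of `burgisserIkenmeyer2011_lemma_6_1_bound` from the tree's proved Strassen–Lickteig
bound `3n² ≤ 2·R̲(⟨n,n,n⟩)` (`three_mul_sq_le_two_mul_algBorderRank_matMulTensor`): for `n ≥ 2`,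
`2(n²+1) < 3n² ≤ 2R̲`. (BI, Rem. 6.2(2): "Lemma 6.1 yields `R̲(⟨2,2,2⟩) > 5`. It is known that
`R̲(⟨2,2,2⟩) = 7`.") [cite: BurgisserIkenmeyer2011, Lemma 6.1] -/
theorem burgisserIkenmeyer2011_lemma_6_1_bound_holds : burgisserIkenmeyer2011_lemma_6_1_bound := by
  intro n hn
  have h3 : 3 * (n * n) ≤ 2 * algBorderRank (matMulTensor ℂ n n n) := by
    simpa [mul_assoc] using three_mul_sq_le_two_mul_algBorderRank_matMulTensor ℂ n hn
  have h4 : 4 ≤ n * n := Nat.mul_le_mul hn hn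
  rw [sq]
  omega

end Literature.Computability.AlgebraicComplexity
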